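import Mathlib
import Summits.HodgeConjecture.HodgeConjecture.Theorems.HodgeLocusCensusKroneckerProfile

/-!
# Hodge-locus census — THE INFINITE JUMP FAMILY `F_{d;1,2}` OF THE CELLS `(4,d,1)`, `d ≥ 6` (THEOREM K-MODEL), for all `d`
(def-free, computable helper of `stmt-HodgeConjecture-16267`; pub-hlocus, seat ivhs-2 = ENGINE B, gen 31; record
`pub-hlocus-ivhs-2/ENGINEB-g31.md` §11 (THEOREM K-MODEL, COROLLARY K-GEN); companion of `HodgeLocusCensusKroneckerProfile.lean`
(THEOREM K⁼: `g = rk + ρ`, `b = H_B(t-d) - ρ`), whose closed forms `g, b, hmin` it reuses.)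

ERRATUM to the companion's docstring: the four census jump members of `(4,d,1)`, `d = 6..9` (GK461, GK471, GK481, GK491) are the
MODEL-FAMILY members `F_{d;1,2}` (the `genK` polynomials of the census), not Fermat members.

Setting (record §11a).  For the model member `F_{d;c',k'}` of a two-plane cell the plane algebra is the monomial complete intersection
`B = K[x_1, …, x_{k'}]/(x_i^{d-1})` and the restricted transition determinant is `δ = (Σ x_i^{d-2})^{c'}`; THEOREM K⁼ makes the jump
`b = H_B(t-d) - ρ` with `ρ = rank (×δ : B_{s-d} → B_{t-d})`.  THEOREM K-MODEL: `ρ = H_min := min(H_B(d), H_B(t-d))` for every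
`(d, c', k')` except `(c', k') = (1, 2)`, `d ≥ 6` — the cells `(4,d,1)` — where `ρ = 2 = H_min - 1`, hence `b(F_{d;1,2}) = 1` and
`g(F_{d;1,2}) = d² + 2d - 14` for every `d ≥ 6`.

This file kernel-checks the exceptional family FOR ALL `d`: with `k' = 2`, `c' = 1` one has `s - d = d - 4`, `t - d = 2d - 6`,
`B_{d-4}` has the monomial basis `x₁^i x₂^{d-4-i}`, `0 ≤ i ≤ d-4` (`d - 3 = H_B(d)` elements, all exponents `≤ d-2` automatically), and
`B_{2d-6}` the basis `x₁^{d-2}x₂^{d-4}, x₁^{d-3}x₂^{d-3}, x₁^{d-4}x₂^{d-2}` (`3 = H_B(t-d)` elements).  `suppMul_basis` proves, for every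
`d ≥ 5` and every `i ≤ d-4`, that the column of `x₁^i x₂^{d-4-i}` under `×(x₁^{d-2} + x₂^{d-2})` is the single monomial `x₁^{d-2}x₂^{d-4}`
if `i = 0`, the single monomial `x₁^{d-4}x₂^{d-2}` if `i = d-4`, and zero otherwise (all coefficients are `1`: no cancellation can occur).
Hence the matrix of `×δ` has exactly two nonzero columns, each with a single entry `1`, in two distinct rows: `ρ = 2` over any field, for
every `d ≥ 5` (paper step: a 0/1 matrix whose columns have pairwise distinct singleton supports has rank = number of nonzero columns).
For `d ≥ 6`, `H_min = min(d-3, 3) = 3 > 2 = ρ`: the model member jumps, `b = 1 = b_gen + 1`; for `d = 5`, `H_min = 2 = ρ`: no jump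
(`b = b_gen = 1`).  The finite
tables `columns_table`, `rho_table`, `gb_table` re-evaluate everything by `decide` for `d = 5..16` and tie the family to the companion's
closed forms (`g 2 d 2 2 = d² + 2d - 14`, `b 2 d 2 2 = 1`, `hmin 2 d 2 = 3`); `g_all_d` is the polynomial identity behind `g = d² + 2d - 14`
for all `d` (`a = C(d+2,2) - 9`); `census_values` recovers program S's certified `g = 34, 49, 66, 85` at `d = 6, 7, 8, 9`.

certified instances and evidence bearing on the general Hodge conjecture; no claim.
-/

set_option maxRecDepth 200000
set_option maxHeartbeats 8000000

namespace Summit.HodgeConjecture.HodgeConjecture.HodgeLocus.Census.ModelJumpFamily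

open Summit.HodgeConjecture.HodgeConjecture.HodgeLocus.Census.KroneckerProfile (g b hmin)

/-- exponent pairs `(i, j - i)` of the monomial basis of `B_j`, `B = K[x₁,x₂]/(x₁^{d-1}, x₂^{d-1})` -/
def basis (d j : ℕ) : List (ℕ × ℕ) :=
  ((List.range (j + 1)).filter (fun i => decide (i ≤ d - 2 ∧ j - i ≤ d - 2))).map (fun i => (i, j - i))

/-- support of `x^e · (x₁^{d-2} + x₂^{d-2})` in `B` (each surviving monomial has coefficient `1`) -/
def suppMul (d : ℕ) (e : ℕ × ℕ) : List (ℕ × ℕ) :=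
  (if e.1 + (d - 2) ≤ d - 2 ∧ e.2 ≤ d - 2 then [(e.1 + (d - 2), e.2)] else []) ++
  (if e.1 ≤ d - 2 ∧ e.2 + (d - 2) ≤ d - 2 then [(e.1, e.2 + (d - 2))] else [])

/-- the columns of the matrix of `×δ : B_{d-4} → B_{2d-6}` in the monomial bases -/
def columns (d : ℕ) : List (List (ℕ × ℕ)) := (basis d (d - 4)).map (suppMul d)

/-- number of distinct nonzero columns (= the rank, since every column is a singleton or empty: `rho_table`, `suppMul_basis`) -/
def rho (d : ℕ) : ℕ := (((columns d).filter (fun c => decide (c ≠ []))).dedup).length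

/-- ALL `d ≥ 5`: the column of `x₁^i x₂^{d-4-i}` is `[x₁^{d-2}x₂^{d-4}]` for `i = 0`, `[x₁^{d-4}x₂^{d-2}]` for `i = d-4`, zero otherwise. -/
theorem suppMul_basis (d i : ℕ) (hd : 5 ≤ d) (hi : i ≤ d - 4) :
    suppMul d (i, d - 4 - i) =
      (if i = 0 then [(d - 2, d - 4)] else []) ++ (if i = d - 4 then [(d - 4, d - 2)] else []) := by
  unfold suppMul
  split_ifs <;>
    simp only [List.nil_append, List.append_nil, List.singleton_append, List.cons.injEq, Prod.mk.injEq, and_true,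
      List.nil_eq, reduceCtorEq] <;> omega

/-- the two nonzero columns sit in DISTINCT rows (`d - 2 ≠ d - 4`) and come from DISTINCT basis monomials (`0 ≠ d - 4`) once `d ≥ 5`. -/
theorem rows_distinct (d : ℕ) (hd : 5 ≤ d) : (d - 2, d - 4) ≠ (d - 4, d - 2) ∧ (0 : ℕ) ≠ d - 4 := by
  refine ⟨?_, by omega⟩
  intro h
  have := (Prod.mk.injEq _ _ _ _).mp h
  omega

/-- every basis monomial of `B_{d-4}` has the shape `x₁^i x₂^{d-4-i}` with `i ≤ d - 4`, for all `d` (so `suppMul_basis` covers every column). -/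
theorem basis_shape (d : ℕ) (e : ℕ × ℕ) (he : e ∈ basis d (d - 4)) : ∃ i, i ≤ d - 4 ∧ e = (i, d - 4 - i) := by
  unfold basis at he
  simp only [List.mem_map, List.mem_filter, List.mem_range, decide_eq_true_eq] at he
  obtain ⟨i, ⟨hi, _⟩, rfl⟩ := he
  exact ⟨i, by omega, rfl⟩

/-- finite re-evaluation, `d = 5..16`: the assembled column list is `[x₁^{d-2}x₂^{d-4}], 0, …, 0, [x₁^{d-4}x₂^{d-2}]`, and the two
bases have `d - 3 = H_B(s-d)` and `3 = H_B(t-d)` elements. -/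
theorem columns_table : ∀ d ∈ List.range' 5 12,
    columns d = [[(d - 2, d - 4)]] ++ List.replicate (d - 5) [] ++ [[(d - 4, d - 2)]] ∧
    (basis d (d - 4)).length = d - 3 ∧ (basis d (2 * d - 6)).length = 3 := by
  decide

/-- finite re-evaluation, `d = 5..16`: every column is a singleton or empty and `ρ = 2`. -/
theorem rho_table : ∀ d ∈ List.range' 5 12, ((columns d).all fun c => decide (c.length ≤ 1)) = true ∧ rho d = 2 := by
  decide

/-- THEOREM K⁼ closed forms of the companion file at `(p, d, c, ρ) = (2, d, 2, 2)`, `d = 6..16`: `H_min = 3 > ρ = 2` (jump),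
`b = 1`, `g = d² + 2d - 14`; and at `d = 5`: `H_min = 2 = ρ` (no jump: `b = 1` is the generic value `(H_B(t-d) - H_B(d))⁺ = 3 - 2` of the cell `(4,5,1)`). -/
theorem gb_table : (∀ d ∈ List.range' 6 11, hmin 2 d 2 = 3 ∧ b 2 d 2 2 = 1 ∧ g 2 d 2 2 = d * d + 2 * d - 14) ∧
    (hmin 2 5 2 = 2 ∧ b 2 5 2 2 = 1) := by
  decide

/-- the polynomial identity behind `g(F_{d;1,2}) = 2a - H_B(d) - H_B(t-d) + ρ = d² + 2d - 14` for ALL `d`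
(`a = C(d+2,2) - 9`, `H_B(d) = d - 3`, `H_B(t-d) = 3`, `ρ = 2`). -/
theorem g_all_d (d a : ℤ) (ha : 2 * a = (d + 2) * (d + 1) - 18) : 2 * a - (d - 3) - 3 + 2 = d ^ 2 + 2 * d - 14 := by
  linear_combination ha

/-- program S's certified generic ranks of GK461, GK471, GK481, GK491 (`d = 6, 7, 8, 9`) are the values of `d² + 2d - 14`. -/
theorem census_values : [6, 7, 8, 9].map (fun d : ℕ => d * d + 2 * d - 14) = [34, 49, 66, 85] := by decide

end Summit.HodgeConjecture.HodgeConjecture.HodgeLocus.Census.ModelJumpFamily
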